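import Summits.Schanuel.Schanuel.Theorems.RootDecomp1EUnsaturatedCore01
import Summits.Schanuel.Schanuel.Theorems.RootDecomp1SaturationLadder

-- `Summit.Schanuel.Schanuel.…` is the mandated layout of this single-problem summit (CONVENTIONS §1).

/-!
# RootDecomp1E — lens 2 «structural dichotomy (special vs generic)», gen 27 (E-R15 (α) SERVICE):
# «SATURATION EXHAUSTION» — owner-of-record reading of lens-1 g25 «SATURATION LADDER» for item stmt-Schanuel-25021

Service file (HOME only unless the critic asks for a port).  Lens-1 g25 proposes the optional root node
N25 : `Schanuel ⟸ FinitarySaturation ∧ SaturatedSchanuel` (kernel `RootDecomp1SaturationLadder.lean`,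
theorem `schanuel_iff_finitarySaturation_and_saturated`), using the 1E aside `SaturatedSchanuel`
(stmt-Schanuel-25021) verbatim as its special piece, and asks the owner (this lens) for consent.  This file
records, kernel-checked and over TREE declarations only (imports: the landed `RootDecomp1EUnsaturatedCore01`, hence
the live `Theses.RootDecomp1E` decls and the 1E anchor toolkit, and the census port `RootDecomp1SaturationLadder`
(p796316, 2026-08-30T23:41Z) of lens-1's kernel, so `FinitarySaturation` is cited BY NAME; its grade at a tuple `z`, which
has no tree name, appears as the verbatim body; no other route's `Theses` enter the cone), what the dichotomy lens
reads in N25 (critic ruling L1445 (3): N25 is booked as TEXTS only — this file is the owner's text in Lean):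

## §1 The exhaustion dictionary (why N25 is a special/generic node of the lens-2 template)

For a tuple `z` write `F_z = ℚ(z, e^z)` and `Γ^alg(z) = {w : w, e^w algebraic over F_z}`.  Lens-1's generic piece at
`z` («`Γ^alg(z)` has bounded ℚ-rank») is EQUIVALENT to the EXHAUSTION statement of the template

  «`z` lies in the ℚ-span of a ℚ-free SATURATED tuple `u ⊂ Γ^alg(z)`»   (`rankBound_iff_saturated_hull`),

`Saturated` being the tree predicate `RootDecomp1EAnchor.Saturated` whose universal closure IS item 25021
(`saturatedSchanuel_iff`, `Iff.rfl`).  So N25 = (summit on the special class: `Sat`) ∧ (every object is carried by a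
special object: `FS`), while the 1E cut of record (tree `RootDecomp1EUnsaturatedCore.schanuel_iff_unsaturated_and_saturated`)
is (summit on the special class: `Sat`) ∧ (summit on the generic class: `UnsaturatedSchanuel = DefectOneSchanuel` 25020).
Same special piece; the generic pieces differ in KIND (finiteness/exhaustion vs an independence inequality) and in
strength (`DefectOneSchanuel ⟹ UniformRankBound ⟹ FS`, lens-1; converses unknown).

## §2 Grade economy (the one structural difference the owner records)

The 1E cut is POINTWISE, hence GRADED: Schanuel at length `n` ⟺ (`U` at length `n`) ∧ (`Sat` at length `n`)
(`schanuelAt_iff_unsaturatedAt_and_saturatedAt`).  N25 is NOT graded: from a rank bound `N` at `z` one needs `Sat`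
at the (unknown) saturation length `m ≤ N` (`le_trdeg_of_rankBound_of_saturatedUpTo`); under `Def_c` the bound is
`N = trdeg F_z + c ≤ 2n + c` (`schanuelAt_of_defectLe_of_saturatedUpTo`), under `FS` alone it is not uniform in `n`.

## §3 The first cells of `Sat` 25021 (owner record, hypothesis-free)

`Sat` (indeed Schanuel) at length `≤ 1` is a THEOREM (Hermite–Lindemann, `schanuelAt_one`; saturation unused).  First
open cell: length 2 at `(1, πi)` — its demand is «`trdeg ℚ(πi, e) ≥ 2`», implied by (and, by the computation inside
`Literature.Barriers.Schanuel.expOnePiAlgebraicIndependent_of_schanuel`, which applies Schanuel only at `(1, πi)`,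
equivalent to) `e ⊥ π` = the registered open statement `ExpOnePiAlgebraicIndependent` (periods.S15)
(`satDemand_onePiI_of_expOnePiAI`); the saturation HYPOTHESIS of the cell is uncertifiable, and the contrapositive is
the rank-1 «lonely point» scenario of TightHull 26810's record (`unsaturated_onePiI_of_trdeg_lt_two`: under `Sat`,
`trdeg ℚ(π, e) < 2` forces an exponential-algebraic point of `ℚ(πi, e)^alg` off the line `ℚ ⊕ ℚπi`).

No `sorry`; no instances, no notation, no unsafe-reducibility options; two imports (landed modules of this summit).
-/


noncomputable section

namespace Summit.Schanuel.Schanuel.Theorems.RootDecomp1ESaturationExhaustion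

open Complex IntermediateField
open scoped Cardinal
open Summit.Schanuel.Schanuel.Theses.RootDecomp1E (DefectOneSchanuel SaturatedSchanuel)
open Summit.Schanuel.Schanuel.Theorems.RootDecomp1EAnchor (Saturated isAlgebraic_of_mem_adjoin
  trdeg_adjoin_le_of_isAlgebraic isAlgebraic_of_isAlgebraic_adjoin isAlgebraic_transfer
  gens_isAlgebraic_of_mem_span trdeg_le_of_mem_span one_le_trdeg_adjoin_singleton isAlgebraic_mul)
open Summit.Schanuel.Schanuel.Theorems.RootDecomp1EUnsaturatedCore (Unsaturated UnsaturatedSchanuel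
  unsaturated_iff_not_saturated)
open Summit.Schanuel.Schanuel.Theorems.RootDecomp1EEngineType (trdeg_eq_nat
  two_le_trdeg_of_algebraicIndependent_of_isAlgebraic)
open Summit.Schanuel.Schanuel.Theorems.RootDecomp1SaturationLadder (FinitarySaturation gens_expAlgebraic
  gens_isAlgebraic_of_expAlgebraic card_le_of_linearIndependent_of_mem_span le_trdeg_of_rankBound_of_saturated
  schanuel_iff_finitarySaturation_and_saturated)
open Literature.NumberTheory.Transcendental (transcendental_exp_holds ExpOnePiAlgebraicIndependent)
open Literature.NumberTheory.Transcendental.OneMotiveToric (trdeg_mono)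
open Literature.Barriers.Schanuel (linearIndependent_one_piI isAlgebraic_I)

/-! ## §0 Identity pins (the item, the tree predicate, lens-1's named piece, the N25 cut) -/

/-- Item stmt-Schanuel-25021 IS «Schanuel at every ℚ-free tuple satisfying the tree predicate `Saturated`». -/
theorem saturatedSchanuel_iff :
    SaturatedSchanuel ↔ ∀ (n : ℕ) (z : Fin n → ℂ), LinearIndependent ℚ z → Saturated n z →
      (n : Cardinal) ≤ Algebra.trdeg ℚ ↥(adjoin ℚ (Set.range z ∪ Set.range (cexp ∘ z))) :=
  Iff.rfl

/-- Lens-1's named piece (tree `RootDecomp1SaturationLadder.FinitarySaturation`) IS the verbatim body used below for its grades. -/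
theorem finitarySaturation_iff :
    FinitarySaturation ↔ ∀ (n : ℕ) (z : Fin n → ℂ), ∃ N : ℕ, ∀ (m : ℕ) (u : Fin m → ℂ),
      (∀ j, IsAlgebraic ↥(adjoin ℚ (Set.range z ∪ Set.range (cexp ∘ z))) (u j) ∧
          IsAlgebraic ↥(adjoin ℚ (Set.range z ∪ Set.range (cexp ∘ z))) (cexp (u j))) →
      LinearIndependent ℚ u → m ≤ N :=
  Iff.rfl

/-- **N25 over the LIVE item.**  The tree's root cut `schanuel_iff_finitarySaturation_and_saturated` has the FQ route decl
`Theses.RootDecomp1E.SaturatedSchanuel` (stmt-Schanuel-25021) as its special conjunct — by elaboration, no rewriting. -/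
theorem schanuel_iff_finitarySaturation_and_saturatedSchanuel :
    _root_.Schanuel ↔ FinitarySaturation ∧ SaturatedSchanuel :=
  schanuel_iff_finitarySaturation_and_saturated

/-! ## §1 The exhaustion dictionary: rank bound at `z` ⟺ `z` is carried by a saturated tuple of `Γ^alg(z)` -/

/-- **Exhaustion, forward.**  A rank bound `N` on `Γ^alg(z)` yields a ℚ-free SATURATED tuple `u ⊂ Γ^alg(z)` of length
`≤ N` whose ℚ-span contains `z` (a maximal ℚ-free family of `Γ^alg(z)`; no hypothesis on `z`). -/
theorem exists_saturated_hull_of_rankBound {n : ℕ} (z : Fin n → ℂ) {N : ℕ}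
    (hN : ∀ (m : ℕ) (u : Fin m → ℂ),
      (∀ j, IsAlgebraic ↥(adjoin ℚ (Set.range z ∪ Set.range (cexp ∘ z))) (u j) ∧
          IsAlgebraic ↥(adjoin ℚ (Set.range z ∪ Set.range (cexp ∘ z))) (cexp (u j))) →
      LinearIndependent ℚ u → m ≤ N) :
    ∃ (m : ℕ) (u : Fin m → ℂ), m ≤ N ∧ LinearIndependent ℚ u ∧ Saturated m u ∧
      (∀ i, z i ∈ Submodule.span ℚ (Set.range u)) ∧
      ∀ j, IsAlgebraic ↥(adjoin ℚ (Set.range z ∪ Set.range (cexp ∘ z))) (u j) ∧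
        IsAlgebraic ↥(adjoin ℚ (Set.range z ∪ Set.range (cexp ∘ z))) (cexp (u j)) := by
  classical
  set F : IntermediateField ℚ ℂ := adjoin ℚ (Set.range z ∪ Set.range (cexp ∘ z)) with hF
  let Q : ℕ → Prop := fun m => ∃ u : Fin m → ℂ, LinearIndependent ℚ u ∧
    ∀ j, IsAlgebraic ↥F (u j) ∧ IsAlgebraic ↥F (cexp (u j))
  have hQ0 : Q 0 := ⟨Fin.elim0, linearIndependent_empty_type, fun j => j.elim0⟩
  set m₀ := Nat.findGreatest Q N with hm₀
  obtain ⟨u, hu, huP⟩ : Q m₀ := Nat.findGreatest_spec (Nat.zero_le N) hQ0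
  -- maximality: Γ^alg(z) ⊆ span u
  have hmax : ∀ w : ℂ, IsAlgebraic ↥F w → IsAlgebraic ↥F (cexp w) → w ∈ Submodule.span ℚ (Set.range u) := by
    intro w hw hew
    by_contra hws
    have hcons : LinearIndependent ℚ (Fin.cons w u : Fin (m₀ + 1) → ℂ) := hu.finCons hws
    have hconsP : ∀ j : Fin (m₀ + 1), IsAlgebraic ↥F ((Fin.cons w u : Fin (m₀ + 1) → ℂ) j) ∧
        IsAlgebraic ↥F (cexp ((Fin.cons w u : Fin (m₀ + 1) → ℂ) j)) := by
      refine Fin.cases ?_ ?_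
      · simpa using And.intro hw hew
      · intro j; simpa using huP j
    have hle : m₀ + 1 ≤ N := hN (m₀ + 1) _ hconsP hcons
    have := Nat.le_findGreatest (P := Q) hle ⟨_, hcons, hconsP⟩
    omega
  have hgen := gens_isAlgebraic_of_expAlgebraic huP
  refine ⟨m₀, u, Nat.findGreatest_le N, hu, ?_, ?_, huP⟩
  · -- `u` is saturated: exponential-algebraic over `F_u` ⟹ over `F_z` ⟹ in `span u`
    intro w hw hew
    exact hmax w (isAlgebraic_of_isAlgebraic_adjoin F hgen hw) (isAlgebraic_of_isAlgebraic_adjoin F hgen hew)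
  · intro i
    exact hmax _ (gens_expAlgebraic z i).1 (gens_expAlgebraic z i).2

/-- **Exhaustion, backward.**  If `z` lies in the span of a SATURATED `u` of length `m`, then every ℚ-free family of
`Γ^alg(z)` has length `≤ m` (`Γ^alg(z) ⊆ span_ℚ u`; equality when moreover `u ⊂ Γ^alg(z)`). -/
theorem rankBound_of_saturated_hull {n m : ℕ} {z : Fin n → ℂ} {u : Fin m → ℂ}
    (hsat : Saturated m u) (hz : ∀ i, z i ∈ Submodule.span ℚ (Set.range u)) :
    ∀ (k : ℕ) (w : Fin k → ℂ),
      (∀ j, IsAlgebraic ↥(adjoin ℚ (Set.range z ∪ Set.range (cexp ∘ z))) (w j) ∧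
          IsAlgebraic ↥(adjoin ℚ (Set.range z ∪ Set.range (cexp ∘ z))) (cexp (w j))) →
      LinearIndependent ℚ w → k ≤ m := by
  intro k w hwP hw
  refine card_le_of_linearIndependent_of_mem_span (u := u) hw fun j => ?_
  exact hsat (w j) (isAlgebraic_transfer hz (hwP j).1) (isAlgebraic_transfer hz (hwP j).2)

/-- **THE EXHAUSTION DICTIONARY.**  Lens-1's `FinitarySaturation` AT `z` (verbatim body) ⟺ «`z` is carried by a ℚ-free
saturated tuple of its own exponential-algebraic closure» — the exhaustion lemma of the special/generic template with
special class = saturated tuples. -/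
theorem rankBound_iff_saturated_hull {n : ℕ} (z : Fin n → ℂ) :
    (∃ N : ℕ, ∀ (m : ℕ) (u : Fin m → ℂ),
      (∀ j, IsAlgebraic ↥(IntermediateField.adjoin ℚ (Set.range z ∪ Set.range (Complex.exp ∘ z))) (u j) ∧
          IsAlgebraic ↥(IntermediateField.adjoin ℚ (Set.range z ∪ Set.range (Complex.exp ∘ z))) (Complex.exp (u j))) →
      LinearIndependent ℚ u → m ≤ N) ↔
    ∃ (m : ℕ) (u : Fin m → ℂ), LinearIndependent ℚ u ∧ Saturated m u ∧
      (∀ i, z i ∈ Submodule.span ℚ (Set.range u)) ∧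
      ∀ j, IsAlgebraic ↥(adjoin ℚ (Set.range z ∪ Set.range (cexp ∘ z))) (u j) ∧
        IsAlgebraic ↥(adjoin ℚ (Set.range z ∪ Set.range (cexp ∘ z))) (cexp (u j)) := by
  constructor
  · rintro ⟨N, hN⟩
    obtain ⟨m, u, -, hu, hsat, hz, huP⟩ := exists_saturated_hull_of_rankBound z hN
    exact ⟨m, u, hu, hsat, hz, huP⟩
  · rintro ⟨m, u, -, hsat, hz, -⟩
    exact ⟨m, rankBound_of_saturated_hull hsat hz⟩

/-- **Global form: `FinitarySaturation` ⟺ EXHAUSTION** — «every finite tuple is carried by a ℚ-free saturated tuple of its own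
exponential-algebraic closure» (the generic piece of N25 is the exhaustion lemma of the special/generic template, special
class = saturated tuples). -/
theorem finitarySaturation_iff_exhaustion :
    FinitarySaturation ↔
    ∀ (n : ℕ) (z : Fin n → ℂ), ∃ (m : ℕ) (u : Fin m → ℂ), LinearIndependent ℚ u ∧ Saturated m u ∧
      (∀ i, z i ∈ Submodule.span ℚ (Set.range u)) ∧
      ∀ j, IsAlgebraic ↥(adjoin ℚ (Set.range z ∪ Set.range (cexp ∘ z))) (u j) ∧
        IsAlgebraic ↥(adjoin ℚ (Set.range z ∪ Set.range (cexp ∘ z))) (cexp (u j)) :=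
  forall_congr' fun _ => forall_congr' fun z => rankBound_iff_saturated_hull z

/-! ## §2 Grade economy: the pointwise 1E cut is graded; N25 consumes `Sat` up to the saturation length -/

/-- **Graded return through a saturated hull.**  Schanuel at a ℚ-free `z` follows from `Sat` AT THE LENGTH `m` of a saturated hull
`u` of `z`: `n ≤ m ≤ trdeg F_u ≤ trdeg F_z`. -/
theorem le_trdeg_of_saturated_hull {n m : ℕ} {z : Fin n → ℂ} (hz : LinearIndependent ℚ z) {u : Fin m → ℂ}
    (hu : LinearIndependent ℚ u) (hsat : Saturated m u) (hzu : ∀ i, z i ∈ Submodule.span ℚ (Set.range u))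
    (huP : ∀ j, IsAlgebraic ↥(adjoin ℚ (Set.range z ∪ Set.range (cexp ∘ z))) (u j) ∧
      IsAlgebraic ↥(adjoin ℚ (Set.range z ∪ Set.range (cexp ∘ z))) (cexp (u j)))
    (hSatm : ∀ (v : Fin m → ℂ), LinearIndependent ℚ v → Saturated m v →
      (m : Cardinal) ≤ Algebra.trdeg ℚ ↥(adjoin ℚ (Set.range v ∪ Set.range (cexp ∘ v)))) :
    (n : Cardinal) ≤ Algebra.trdeg ℚ ↥(adjoin ℚ (Set.range z ∪ Set.range (cexp ∘ z))) := by
  have h1 : n ≤ m := card_le_of_linearIndependent_of_mem_span hz hzu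
  have h2 : (m : Cardinal) ≤ Algebra.trdeg ℚ ↥(adjoin ℚ (Set.range u ∪ Set.range (cexp ∘ u))) := hSatm u hu hsat
  have h3 : Algebra.trdeg ℚ ↥(adjoin ℚ (Set.range u ∪ Set.range (cexp ∘ u))) ≤
      Algebra.trdeg ℚ ↥(adjoin ℚ (Set.range z ∪ Set.range (cexp ∘ z))) :=
    trdeg_adjoin_le_of_isAlgebraic (gens_isAlgebraic_of_expAlgebraic huP)
  calc (n : Cardinal) ≤ (m : Cardinal) := by exact_mod_cast h1
    _ ≤ _ := h2
    _ ≤ _ := h3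

/-- **N25's return map, graded.**  A rank bound `N` at `z` plus `Sat` at every length `≤ N` give Schanuel at `z` (lens-1's
`le_trdeg_of_rankBound_of_saturated` with the global 25021 replaced by its grades `≤ N`). -/
theorem le_trdeg_of_rankBound_of_saturatedUpTo {n : ℕ} {z : Fin n → ℂ} (hz : LinearIndependent ℚ z) {N : ℕ}
    (hN : ∀ (m : ℕ) (u : Fin m → ℂ),
      (∀ j, IsAlgebraic ↥(adjoin ℚ (Set.range z ∪ Set.range (cexp ∘ z))) (u j) ∧
          IsAlgebraic ↥(adjoin ℚ (Set.range z ∪ Set.range (cexp ∘ z))) (cexp (u j))) →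
      LinearIndependent ℚ u → m ≤ N)
    (hSat : ∀ m ≤ N, ∀ (v : Fin m → ℂ), LinearIndependent ℚ v → Saturated m v →
      (m : Cardinal) ≤ Algebra.trdeg ℚ ↥(adjoin ℚ (Set.range v ∪ Set.range (cexp ∘ v)))) :
    (n : Cardinal) ≤ Algebra.trdeg ℚ ↥(adjoin ℚ (Set.range z ∪ Set.range (cexp ∘ z))) := by
  obtain ⟨m, u, hmN, hu, hsat, hzu, huP⟩ := exists_saturated_hull_of_rankBound z hN
  exact le_trdeg_of_saturated_hull hz hu hsat hzu huP (hSat m hmN)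

/-- Under `Def_c` (Schanuel with defect `≤ c`, global, verbatim shape of 25020 for `c = 1`) the saturation rank at a tuple of
length `n` is at most `trdeg F_z + c ≤ 2n + c`. -/
theorem rankBound_of_defectLe (c : ℕ)
    (hc : ∀ (n : ℕ) (z : Fin n → ℂ), LinearIndependent ℚ z →
      (n : Cardinal) ≤ Algebra.trdeg ℚ ↥(IntermediateField.adjoin ℚ (Set.range z ∪ Set.range (Complex.exp ∘ z))) + c)
    {n : ℕ} (z : Fin n → ℂ) :
    ∀ (m : ℕ) (u : Fin m → ℂ),
      (∀ j, IsAlgebraic ↥(adjoin ℚ (Set.range z ∪ Set.range (cexp ∘ z))) (u j) ∧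
          IsAlgebraic ↥(adjoin ℚ (Set.range z ∪ Set.range (cexp ∘ z))) (cexp (u j))) →
      LinearIndependent ℚ u → m ≤ n + n + c := by
  intro m u huP hu
  obtain ⟨t, ht, htn⟩ := trdeg_eq_nat z
  have h1 := hc m u hu
  have h2 : Algebra.trdeg ℚ ↥(adjoin ℚ (Set.range u ∪ Set.range (cexp ∘ u))) ≤
      Algebra.trdeg ℚ ↥(adjoin ℚ (Set.range z ∪ Set.range (cexp ∘ z))) :=
    trdeg_adjoin_le_of_isAlgebraic (gens_isAlgebraic_of_expAlgebraic huP)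
  have h3 : (m : Cardinal) ≤ ((t + c : ℕ) : Cardinal) := by
    rw [Nat.cast_add, ← ht]
    exact h1.trans (add_le_add h2 le_rfl)
  have h4 : m ≤ t + c := by exact_mod_cast h3
  omega

/-- **Grade cost of the N25-type cut under `Def_c`.**  `Def_c` (global) and `Sat` at all lengths `≤ 2n + c` give Schanuel at
length `n`.  (The pointwise 1E cut needs `Sat` at length `n` only: next theorem.) -/
theorem schanuelAt_of_defectLe_of_saturatedUpTo (c n : ℕ)
    (hc : ∀ (n : ℕ) (z : Fin n → ℂ), LinearIndependent ℚ z →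
      (n : Cardinal) ≤ Algebra.trdeg ℚ ↥(IntermediateField.adjoin ℚ (Set.range z ∪ Set.range (Complex.exp ∘ z))) + c)
    (hSat : ∀ m ≤ n + n + c, ∀ (v : Fin m → ℂ), LinearIndependent ℚ v → Saturated m v →
      (m : Cardinal) ≤ Algebra.trdeg ℚ ↥(adjoin ℚ (Set.range v ∪ Set.range (cexp ∘ v)))) :
    ∀ z : Fin n → ℂ, LinearIndependent ℚ z →
      (n : Cardinal) ≤ Algebra.trdeg ℚ ↥(adjoin ℚ (Set.range z ∪ Set.range (cexp ∘ z))) :=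
  fun z hz => le_trdeg_of_rankBound_of_saturatedUpTo hz (rankBound_of_defectLe c hc z) hSat

/-- The `c = 1` row over the LIVE item: `DefectOneSchanuel` (stmt-Schanuel-25020) and `Sat` at lengths `≤ 2n + 1` give Schanuel
at length `n`. -/
theorem schanuelAt_of_defectOne_of_saturatedUpTo (n : ℕ) (hD : DefectOneSchanuel)
    (hSat : ∀ m ≤ n + n + 1, ∀ (v : Fin m → ℂ), LinearIndependent ℚ v → Saturated m v →
      (m : Cardinal) ≤ Algebra.trdeg ℚ ↥(adjoin ℚ (Set.range v ∪ Set.range (cexp ∘ v)))) :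
    ∀ z : Fin n → ℂ, LinearIndependent ℚ z →
      (n : Cardinal) ≤ Algebra.trdeg ℚ ↥(adjoin ℚ (Set.range z ∪ Set.range (cexp ∘ z))) :=
  schanuelAt_of_defectLe_of_saturatedUpTo 1 n (fun k w hw => by exact_mod_cast hD k w hw) hSat

/-- **The 1E cut of record is GRADED** (pointwise partition by the saturation dichotomy, grade by grade): Schanuel at
length `n` ⟺ (Schanuel at the UNSATURATED ℚ-free tuples of length `n`) ∧ (Schanuel at the SATURATED ones of length `n`).
Global form: tree `RootDecomp1EUnsaturatedCore.schanuel_iff_unsaturated_and_saturated`. -/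
theorem schanuelAt_iff_unsaturatedAt_and_saturatedAt (n : ℕ) :
    (∀ z : Fin n → ℂ, LinearIndependent ℚ z →
      (n : Cardinal) ≤ Algebra.trdeg ℚ ↥(adjoin ℚ (Set.range z ∪ Set.range (cexp ∘ z)))) ↔
    ((∀ z : Fin n → ℂ, LinearIndependent ℚ z → Unsaturated z →
        (n : Cardinal) ≤ Algebra.trdeg ℚ ↥(adjoin ℚ (Set.range z ∪ Set.range (cexp ∘ z)))) ∧
      ∀ z : Fin n → ℂ, LinearIndependent ℚ z → Saturated n z →
        (n : Cardinal) ≤ Algebra.trdeg ℚ ↥(adjoin ℚ (Set.range z ∪ Set.range (cexp ∘ z)))) := by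
  constructor
  · intro h
    exact ⟨fun z hz _ => h z hz, fun z hz _ => h z hz⟩
  · rintro ⟨hU, hS⟩ z hz
    by_cases hs : Saturated n z
    · exact hS z hz hs
    · exact hU z hz ((unsaturated_iff_not_saturated z).2 hs)

/-! ## §3 First cells of `Sat` (stmt-Schanuel-25021): length `≤ 1` decided, first open cell `(1, πi)` -/

/-- **Schanuel at length 1 is a theorem** (Hermite–Lindemann; tree `transcendental_exp_holds`): for `z ≠ 0`, one of `z`, `e^z` is
transcendental. -/
theorem schanuelAt_one (z : Fin 1 → ℂ) (hz : LinearIndependent ℚ z) :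
    ((1 : ℕ) : Cardinal) ≤ Algebra.trdeg ℚ ↥(adjoin ℚ (Set.range z ∪ Set.range (cexp ∘ z))) := by
  have hne : z 0 ≠ 0 := hz.ne_zero 0
  by_cases halg : IsAlgebraic ℚ (z 0)
  · have htr : ¬ IsAlgebraic ℚ (cexp (z 0)) := transcendental_exp_holds halg hne
    refine (one_le_trdeg_adjoin_singleton htr).trans (trdeg_mono (adjoin.mono ℚ _ _ ?_))
    intro x hx
    rw [Set.mem_singleton_iff] at hx
    subst hx
    exact Or.inr ⟨0, rfl⟩
  · refine (one_le_trdeg_adjoin_singleton halg).trans (trdeg_mono (adjoin.mono ℚ _ _ ?_))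
    intro x hx
    rw [Set.mem_singleton_iff] at hx
    subst hx
    exact Or.inl ⟨0, rfl⟩

/-- `Sat` (25021) at length `≤ 1` holds outright (the saturation hypothesis is not used): the decided layer of the item. -/
theorem saturatedSchanuelAt_le_one {n : ℕ} (hn : n ≤ 1) (z : Fin n → ℂ) (hz : LinearIndependent ℚ z)
    (_hs : Saturated n z) :
    (n : Cardinal) ≤ Algebra.trdeg ℚ ↥(adjoin ℚ (Set.range z ∪ Set.range (cexp ∘ z))) := by
  interval_cases n
  · simp
  · exact schanuelAt_one z hz

/-- The first open cell: `z₁ = (1, πi)` (so `e^{z₁} = (e, −1)` and `F_{z₁} = ℚ(πi, e)`). -/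
def onePiI : Fin 2 → ℂ := ![(1 : ℂ), ↑Real.pi * I]

/-- `I` is algebraic over every intermediate field (tree `Literature.Barriers.Schanuel.isAlgebraic_I`, lifted). -/
private theorem isAlgebraic_I_over (K : IntermediateField ℚ ℂ) : IsAlgebraic ↥K I :=
  isAlgebraic_I.tower_top _

/-- **The demand of `Sat`'s first open cell follows from `e ⊥ π`**, the REGISTERED open statement `ExpOnePiAlgebraicIndependent`
(periods.S15; a consequence of Schanuel — tree `Literature.Barriers.Schanuel.expOnePiAlgebraicIndependent_of_schanuel`, whose
computation uses Schanuel at `(1, πi)` only — open in print): it gives `trdeg ℚ(πi, e) ≥ 2`, the conclusion of 25021 at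
`(1, πi)` (ℚ-free: tree `Literature.Barriers.Schanuel.linearIndependent_one_piI`) — whether or not `(1, πi)` is saturated. -/
theorem satDemand_onePiI_of_expOnePiAI (h : ExpOnePiAlgebraicIndependent) :
    (2 : Cardinal) ≤ Algebra.trdeg ℚ ↥(adjoin ℚ (Set.range onePiI ∪ Set.range (cexp ∘ onePiI))) := by
  have h2 : AlgebraicIndependent ℚ ![cexp 1, (Real.pi : ℂ)] := by
    have e : (![cexp 1, (Real.pi : ℂ)] : Fin 2 → ℂ) =
        (Complex.ofRealAm.restrictScalars ℚ) ∘ ![Real.exp 1, Real.pi] := by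
      funext i; fin_cases i <;> simp [Complex.ofReal_exp]
    rw [e]
    have h' : AlgebraicIndependent ℚ ![Real.exp 1, Real.pi] := by
      unfold ExpOnePiAlgebraicIndependent at h
      exact h
    exact h'.map' Complex.ofReal_injective
  refine two_le_trdeg_of_algebraicIndependent_of_isAlgebraic onePiI h2 fun i => ?_
  fin_cases i
  · -- `e = e^{z₁ 0}` is a generator
    have hm : cexp 1 ∈ adjoin ℚ (Set.range onePiI ∪ Set.range (cexp ∘ onePiI)) :=
      subset_adjoin ℚ _ (Or.inr ⟨0, by simp [onePiI]⟩)
    simpa using isAlgebraic_of_mem_adjoin hm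
  · -- `π = (πi) · (−i)` is algebraic over `F_{z₁}`
    have hm : (↑Real.pi * I : ℂ) ∈ adjoin ℚ (Set.range onePiI ∪ Set.range (cexp ∘ onePiI)) :=
      subset_adjoin ℚ _ (Or.inl ⟨1, by simp [onePiI]⟩)
    have halg : IsAlgebraic ↥(adjoin ℚ (Set.range onePiI ∪ Set.range (cexp ∘ onePiI))) ((↑Real.pi * I) * (-I)) :=
      isAlgebraic_mul (isAlgebraic_of_mem_adjoin hm) (isAlgebraic_I_over _).neg
    have hpi : (↑Real.pi * I) * (-I) = (Real.pi : ℂ) := by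
      rw [mul_assoc, mul_neg, Complex.I_mul_I, neg_neg, mul_one]
    rw [hpi] at halg
    simpa using halg

/-- **The lonely-point reading of the first open cell.**  Under `Sat` (25021), if `trdeg ℚ(πi, e) < 2` (i.e. `e` and `π` are
algebraically DEPENDENT), then `(1, πi)` is UNSATURATED: some `w ∉ ℚ ⊕ ℚπi` has `w, e^w` algebraic over `ℚ(πi, e)` — the rank-1
«lonely point» scenario of TightHull 26810's record, census shadow RELATION-EXCLUSION-v1 row `P1_e_pi`. -/
theorem unsaturated_onePiI_of_trdeg_lt_two (hSat : SaturatedSchanuel)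
    (hlt : Algebra.trdeg ℚ ↥(adjoin ℚ (Set.range onePiI ∪ Set.range (cexp ∘ onePiI))) < (2 : Cardinal)) :
    Unsaturated onePiI := by
  rw [unsaturated_iff_not_saturated]
  intro hs
  have h := hSat 2 onePiI linearIndependent_one_piI hs
  exact absurd h (not_le.mpr (by exact_mod_cast hlt))

end Summit.Schanuel.Schanuel.Theorems.RootDecomp1ESaturationExhaustion
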